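import Literature.NumberTheory.LFunctions.WeilMarkovQuadratic
import Mathlib.Analysis.SpecialFunctions.ImproperIntegrals
import Mathlib.MeasureTheory.Integral.ExpDecay
import Mathlib.Analysis.Complex.Exponential
import HarnessLib

/-!
# Semi-local threshold, negative side — the archimedean TAIL `∫_{2b}^∞ w` as a rational number

Cell `rh-explicit` (HOME `run/shared/lean/pub/rh-explicit/`), seat cc-s2-4 (`HOME/cc-s2-4/CC4-THRESHOLD-PLAN.md` §2).
Honest framing: bookkeeping for NEGATIVE certificates about the tree's `weilSemilocalThreshold {2}`; nothing here
bears on RH.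

For a Markov witness supported in `[−b, b]` the increment is constant `D_t(G) = 2‖G‖²` for `t > 2b`, so the tail of
the archimedean energy is `2‖G‖² · ∫_{2b}^∞ w`, `w(t) = e^{t/2}/(2 sinh t) = e^{−t/2}/(1 − e^{−2t})`.  lad-2's rung used the
three-term majorant `e^{−t/2} + e^{−5t/2} + e^{−9t/2}/(1 − e^{−2c})` (`weilArchDensity_le_tail`) and an interval `exp`;
the planned rungs need `≈ 10⁻⁹` relative accuracy, so here:

* `weilArchDensity_le_geomTail`: for `0 < c ≤ t` and every `K`,
  `w(t) ≤ Σ_{k≤K} e^{−(2k+½)t} + e^{−(2K+5/2)t}/(1 − e^{−2c})` (finite geometric identity, no limits);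
* `setIntegral_Ioi_weilArchDensity_le`: `∫_{(c,∞)} w ≤ Σ_{k≤K} e^{−(2k+½)c}/(2k+½) + e^{−(2K+5/2)c}/((2K+5/2)(1 − e^{−2c}))`;
* `exp_neg_le_invPartialExp`: `e^{−x} ≤ 1/Σ_{j<n} x^j/j!` for `x ≥ 0` (`Real.sum_le_exp_of_nonneg`), which turns the
  bound into the RATIONAL `archTailQ c K n` (`setIntegral_Ioi_weilArchDensity_le_archTailQ`), evaluated by the kernel.

References: E. Bombieri, Rend. Mat. Acc. Lincei (9) 11 (2000) Thm 2 (the density); folklore otherwise.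
-/

set_option linter.dupNamespace false  -- the mandated namespace repeats `RiemannHypothesis`

noncomputable section

open MeasureTheory Set Finset Real
open Literature.NumberTheory.LFunctions

namespace Summit.RiemannHypothesis.RiemannHypothesis.Theorems.SemilocalPolyWitness

/-! ## The geometric tail majorant of `w` -/

/-- `w(t) = e^{−t/2}/(1 − e^{−2t})` for `t > 0`. -/
theorem weilArchDensity_eq_exp_neg {t : ℝ} (ht : 0 < t) :
    weilArchDensity t = Real.exp (-(t / 2)) / (1 - Real.exp (-(2 * t))) := by
  unfold weilArchDensity
  rw [Real.sinh_eq]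
  have h1 : Real.exp (-(t / 2)) = Real.exp (t / 2) * Real.exp (-t) := by
    rw [← Real.exp_add]; ring_nf
  have h2 : Real.exp (-(2 * t)) = Real.exp (-t) * Real.exp (-t) := by
    rw [← Real.exp_add]; ring_nf
  have h3 : Real.exp t * Real.exp (-t) = 1 := by rw [← Real.exp_add]; simp
  have hpos : 0 < Real.exp t - Real.exp (-t) := by
    have : Real.exp (-t) < Real.exp t := Real.exp_lt_exp.2 (by linarith)
    linarith
  have hpos' : 0 < 1 - Real.exp (-(2 * t)) := by
    have : Real.exp (-(2 * t)) < 1 := Real.exp_lt_one_iff.2 (by linarith)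
    linarith
  rw [div_eq_div_iff (by positivity) hpos'.ne', h1, h2]
  nlinarith [h3, Real.exp_pos (t / 2), Real.exp_pos (-t)]

/-- **Geometric tail majorant**: for `0 < c ≤ t`,
`w(t) ≤ Σ_{k<K+1} e^{−(2k+1/2)t} + e^{−(2K+5/2)t}/(1 − e^{−2c})`. -/
theorem weilArchDensity_le_geomTail (K : ℕ) {c t : ℝ} (hc : 0 < c) (hct : c ≤ t) :
    weilArchDensity t ≤ (∑ k ∈ range (K + 1), Real.exp (-((2 * k + 1 / 2) * t)))
      + Real.exp (-((2 * K + 5 / 2) * t)) / (1 - Real.exp (-(2 * c))) := by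
  have ht : 0 < t := lt_of_lt_of_le hc hct
  rw [weilArchDensity_eq_exp_neg ht]
  set x := Real.exp (-(2 * t)) with hx
  set s := Real.exp (-(t / 2)) with hs
  have hx0 : 0 < x := Real.exp_pos _
  have hx1 : x < 1 := Real.exp_lt_one_iff.2 (by linarith)
  have hxc : x ≤ Real.exp (-(2 * c)) := Real.exp_le_exp.2 (by linarith)
  have hc1 : Real.exp (-(2 * c)) < 1 := Real.exp_lt_one_iff.2 (by linarith)
  -- the exponentials as products of `s` and powers of `x`
  have hk : ∀ k : ℕ, Real.exp (-((2 * k + 1 / 2) * t)) = s * x ^ k := by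
    intro k
    rw [hs, hx, ← Real.exp_nat_mul, ← Real.exp_add]
    congr 1; ring
  have hK : Real.exp (-((2 * K + 5 / 2) * t)) = s * x ^ (K + 1) := by
    rw [hs, hx, ← Real.exp_nat_mul, ← Real.exp_add]
    congr 1; push_cast; ring
  simp_rw [hk, hK]
  rw [← Finset.mul_sum]
  -- finite geometric identity: Σ_{k<K+1} x^k = (1 − x^{K+1})/(1 − x)
  have hgeom : ∑ k ∈ range (K + 1), x ^ k = (1 - x ^ (K + 1)) / (1 - x) := by
    have h := geom_sum_mul_neg x (K + 1)
    rw [eq_div_iff (sub_pos.2 hx1).ne']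
    linarith
  rw [hgeom]
  have h1x : 0 < 1 - x := sub_pos.2 hx1
  have hrest : s * x ^ (K + 1) / (1 - x) ≤ s * x ^ (K + 1) / (1 - Real.exp (-(2 * c))) :=
    div_le_div_of_nonneg_left (by positivity) (sub_pos.2 hc1) (by linarith)
  have hsplit : s / (1 - x) = s * ((1 - x ^ (K + 1)) / (1 - x)) + s * x ^ (K + 1) / (1 - x) := by
    field_simp
    ring
  rw [hsplit]
  linarith

/-! ## The tail integral -/

/-- `∫_{(c,∞)} e^{−a t} dt = e^{−a c}/a` for `a > 0`. -/
theorem integral_Ioi_exp_neg_mul {a c : ℝ} (ha : 0 < a) :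
    ∫ t in Ioi c, Real.exp (-(a * t)) = Real.exp (-(a * c)) / a := by
  have h := integral_exp_mul_Ioi (a := -a) (by linarith) c
  have e : (fun t ↦ Real.exp (-(a * t))) = fun t ↦ Real.exp (-a * t) := by
    funext t; congr 1; ring
  rw [e, h]
  rw [show -a * c = -(a * c) by ring]
  field_simp

/-- `t ↦ e^{−a t}` is integrable on `(c, ∞)` for `a > 0`. -/
theorem integrableOn_Ioi_exp_neg_mul {a : ℝ} (c : ℝ) (ha : 0 < a) :
    IntegrableOn (fun t ↦ Real.exp (-(a * t))) (Ioi c) := by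
  have h := exp_neg_integrableOn_Ioi c ha
  refine h.congr_fun (fun t _ ↦ ?_) measurableSet_Ioi
  simp only; congr 1; ring

/-- **Tail bound**: for `c > 0`,
`∫_{(c,∞)} w ≤ Σ_{k<K+1} e^{−(2k+½)c}/(2k+½) + e^{−(2K+5/2)c}/((2K+5/2)(1 − e^{−2c}))`, and `w` is integrable there. -/
theorem setIntegral_Ioi_weilArchDensity_le (K : ℕ) {c : ℝ} (hc : 0 < c) :
    IntegrableOn weilArchDensity (Ioi c) ∧
      ∫ t in Ioi c, weilArchDensity t ≤
        (∑ k ∈ range (K + 1), Real.exp (-((2 * k + 1 / 2) * c)) / (2 * k + 1 / 2))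
          + Real.exp (-((2 * K + 5 / 2) * c)) / ((2 * K + 5 / 2) * (1 - Real.exp (-(2 * c)))) := by
  have hc1 : 0 < 1 - Real.exp (-(2 * c)) := sub_pos.2 (Real.exp_lt_one_iff.2 (by linarith))
  set m : ℝ → ℝ := fun t ↦ (∑ k ∈ range (K + 1), Real.exp (-((2 * k + 1 / 2) * t)))
      + Real.exp (-((2 * K + 5 / 2) * t)) / (1 - Real.exp (-(2 * c))) with hm
  have hmi : IntegrableOn m (Ioi c) := by
    refine (integrable_finsetSum _ fun k _ ↦ integrableOn_Ioi_exp_neg_mul c (by positivity)).add ?_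
    exact (integrableOn_Ioi_exp_neg_mul c (by positivity)).div_const _
  have hmeas : AEStronglyMeasurable weilArchDensity (volume.restrict (Ioi c)) := by
    have : Measurable weilArchDensity := by unfold weilArchDensity; fun_prop
    exact this.aestronglyMeasurable
  have hle : ∀ t ∈ Ioi c, weilArchDensity t ≤ m t := fun t ht ↦ weilArchDensity_le_geomTail K hc ht.le
  have hint : IntegrableOn weilArchDensity (Ioi c) := by
    refine Integrable.mono' hmi hmeas ?_
    filter_upwards [ae_restrict_mem measurableSet_Ioi] with t ht
    rw [Real.norm_eq_abs, abs_of_pos (weilArchDensity_pos (hc.trans ht))]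
    exact hle t ht
  refine ⟨hint, (setIntegral_mono_on hint hmi measurableSet_Ioi hle).trans (le_of_eq ?_)⟩
  rw [hm, integral_add (integrable_finsetSum _ fun k _ ↦ integrableOn_Ioi_exp_neg_mul c (by positivity))
    ((integrableOn_Ioi_exp_neg_mul c (by positivity)).div_const _),
    integral_finsetSum _ fun k _ ↦ integrableOn_Ioi_exp_neg_mul c (by positivity), integral_div,
    integral_Ioi_exp_neg_mul (by positivity)]
  congr 1
  · exact Finset.sum_congr rfl fun k _ ↦ integral_Ioi_exp_neg_mul (by positivity)
  · rw [div_div]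

/-! ## Rational upper bounds for `e^{−x}` and the rational tail -/

/-- `1/Σ_{j<n} x^j/j!` — a rational upper bound of `e^{−x}` for rational `x ≥ 0` (`n ≥ 1`). -/
def invPartialExpQ (n : ℕ) (x : ℚ) : ℚ := 1 / ∑ j ∈ range n, x ^ j / j.factorial

/-- The partial exponential sum at `x ≥ 0` is at least its first term `1`. -/
theorem one_le_partialExp {n : ℕ} (hn : 0 < n) {x : ℝ} (hx : 0 ≤ x) :
    (1 : ℝ) ≤ ∑ j ∈ range n, x ^ j / j.factorial := by
  have h := Finset.single_le_sum (f := fun j ↦ x ^ j / (j.factorial : ℝ)) (fun j _ ↦ by positivity)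
    (mem_range.2 hn)
  simpa using h

/-- `e^{−x} ≤ 1/Σ_{j<n} x^j/j!` for `x ≥ 0`, `n ≥ 1`. -/
theorem exp_neg_le_invPartialExpQ {n : ℕ} (hn : 0 < n) {x : ℚ} (hx : 0 ≤ x) :
    Real.exp (-(x : ℝ)) ≤ (invPartialExpQ n x : ℝ) := by
  have hx' : (0 : ℝ) ≤ x := by exact_mod_cast hx
  have hS : ∑ j ∈ range n, (x : ℝ) ^ j / j.factorial ≤ Real.exp x := Real.sum_le_exp_of_nonneg hx' n
  have hSpos : 0 < ∑ j ∈ range n, (x : ℝ) ^ j / j.factorial :=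
    lt_of_lt_of_le one_pos (one_le_partialExp hn hx')
  rw [invPartialExpQ, Real.exp_neg]
  push_cast
  rw [one_div]
  exact inv_anti₀ hSpos hS

/-- `0 < invPartialExpQ n x` for `x ≥ 0`, `n ≥ 1`. -/
theorem invPartialExpQ_pos {n : ℕ} (hn : 0 < n) {x : ℚ} (hx : 0 ≤ x) : 0 < (invPartialExpQ n x : ℝ) := by
  have hx' : (0 : ℝ) ≤ x := by exact_mod_cast hx
  rw [invPartialExpQ]
  push_cast
  exact div_pos one_pos (lt_of_lt_of_le one_pos (one_le_partialExp hn hx'))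

/-- The rational tail bound: `Σ_{k≤K} (2/(4k+1))·ē((2k+½)c) + ē((2K+5/2)c)/((2K+5/2)(1 − ē(2c)))` with
`ē(x) = invPartialExpQ n x ≥ e^{−x}` (the last `ē(2c)` must be `< 1`, checked by the caller). -/
def archTailQ (c : ℚ) (K n : ℕ) : ℚ :=
  (∑ k ∈ range (K + 1), invPartialExpQ n ((2 * k + 1 / 2) * c) / (2 * k + 1 / 2))
    + invPartialExpQ n ((2 * K + 5 / 2) * c) / ((2 * K + 5 / 2) * (1 - invPartialExpQ n (2 * c)))

/-- **The tail as a rational**: for rational `c > 0`, `n ≥ 1` and `invPartialExpQ n (2c) < 1`,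
`∫_{(c,∞)} w ≤ archTailQ c K n`. -/
theorem setIntegral_Ioi_weilArchDensity_le_archTailQ (K : ℕ) {n : ℕ} (hn : 0 < n) {c : ℚ} (hc : 0 < c)
    (h1 : invPartialExpQ n (2 * c) < 1) :
    ∫ t in Ioi (c : ℝ), weilArchDensity t ≤ (archTailQ c K n : ℝ) := by
  have hc' : (0 : ℝ) < c := by exact_mod_cast hc
  refine (setIntegral_Ioi_weilArchDensity_le K hc').2.trans ?_
  rw [archTailQ]
  push_cast
  have hE : ∀ y : ℚ, 0 ≤ y → Real.exp (-(y : ℝ)) ≤ (invPartialExpQ n y : ℝ) :=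
    fun y hy ↦ exp_neg_le_invPartialExpQ hn hy
  refine add_le_add (Finset.sum_le_sum fun k _ ↦ ?_) ?_
  · have h := hE ((2 * k + 1 / 2) * c) (by positivity)
    push_cast at h
    exact div_le_div_of_nonneg_right h (by positivity)
  · have hK := hE ((2 * K + 5 / 2) * c) (by positivity)
    push_cast at hK
    have h2 := hE (2 * c) (by positivity)
    push_cast at h2
    have h1' : (invPartialExpQ n (2 * c) : ℝ) < 1 := by exact_mod_cast h1
    have hKpos := invPartialExpQ_pos hn (show (0 : ℚ) ≤ (2 * K + 5 / 2) * c by positivity)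
    refine div_le_div₀ hKpos.le hK (by nlinarith) ?_
    nlinarith

end Summit.RiemannHypothesis.RiemannHypothesis.Theorems.SemilocalPolyWitness

end
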